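import Literature.Analysis.FluidPDE.PalmLocalState
import HarnessLib

/-!
# The Palm frame for local states of hard-sphere systems, I′: proof of Palm uniqueness
(Kallenberg, *Foundations of Modern Probability*, Prop. 11.3)

Topic `Literature/Analysis/FluidPDE`; companion PROOF file of `PalmLocalState.lean` (which states the
named fact `Literature.Analysis.FluidPDE.PalmUniqueness`: two translation-invariant probability laws
on configurations of `ℝᵈ × ℝᵈ` with the same finite positive intensity and the same Palm law are
equal). This file discharges it, `PalmUniqueness_holds`, by transcribing the printed proof of
Kallenberg's Prop. 11.3 ("uniqueness and inversion", part (i)) to configurations of `ℝᵈ × ℝᵈ` with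
shifts acting on positions. Dictionary: `ξ` = the ground configuration of positions of
`ω : PointConfig (ℝᵈ × ℝᵈ)`, `θ_s ω = ω - (s, 0)` (`recentre`), `E ξ̄` = `intensity P` (per unit cube
`[0,1)ᵈ`, of volume `1`), `Q_{X,ξ}` = `palmLaw P`, `{ξ ≠ 0}` = `{ω | ω.count univ ≠ 0}`.

## Contents (in the order of the printed proof)

* `lintegral_tsum_translate_eq`, `lintegral_compProd_countKernel_translate_eq`: STATIONARITY IN
  CAMPBELL FORM — for translation-invariant `P` the Campbell measure `C_P = P ⊗ₘ countKernel` is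
  invariant under `(ω, p) ↦ (ω + (a,0), p + (a,0))` (the computation in the proof of Kallenberg's
  Lemma 11.2).
* `lintegral_tsum_recentre_eq`, `lintegral_tsum_recentre_eq_mul_palmLaw`: the REFINED CAMPBELL
  THEOREM `E_P ∑_{p ∈ ω} h(ω - (x_p,0), x_p) = ρ ∫∫ h(η, z) dz P⁰(dη)` (Kallenberg's extension of (1),
  `E ξ̄ · E ∫ h(Y,η,s) ds = E ∫ h(θ_s(X,ξ), s) ξ(ds)`; Last–Penrose Thm. 9.1). DEVIATION FROM PRINT:
  proved by Mecke's averaging argument (insert `1 = ∫ 1_{[0,1)ᵈ}(x_p + y) dy`, Tonelli, shift by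
  `-y`, Tonelli, translation invariance of Lebesgue measure) instead of a monotone-class extension
  of (1) — it gives general measurable `h ≥ 0` directly.
* `lintegral_tsum_eq_mul_palmLaw`: Kallenberg's formula (2),
  `E_P ∑_{p ∈ ω} F(ω, x_p) = ρ ∫∫ F(η + (s,0), s) ds P⁰(dη)` (the substitution `s ↦ -s` of the print is
  not performed).
* `ae_tsum_weight_lt_top`: "`ξ g < ∞` a.s. if `λᵈ g < ∞`" — `∑_{p ∈ ω} g(x_p) < ∞` a.s., its
  expectation being `ρ ∫ g`.
* `lintegral_indicator_count_ne_zero_eq_mul_palmLaw`: the INVERSION FORMULA Prop. 11.3 (i),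
  `E_P[f; ω ≠ ∅] = ρ ∫∫ f(η + (s,0)) g(s) / (∑_{q ∈ η + (s,0)} g(x_q)) ds P⁰(dη)` for measurable `f ≥ 0`
  and any measurable weight `g > 0` with `∫ g < ∞`.
* `PalmUniqueness_holds`: with `g(s) = (1 + |s|)^{-(d+1)}` the right-hand side is a functional of
  `(ρ, P⁰)`, so `P[· ; ω ≠ ∅]` is determined; `{ω = ∅}` is a single configuration of mass
  `1 - P{ω ≠ ∅}` ("the latter equation also expresses `P{ξ ≠ 0}/E ξ̄` in terms of `L(η)`").
* Folklore helpers: `pointConfig_translate_translate`, `pointConfig_translate_zero`,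
  `tsum_pointConfig_translate`, `recentre_translate`, and a private copy of `volume [0,1)ᵈ = 1`.

## References

* O. Kallenberg, *Foundations of Modern Probability* (held copy), Ch. 11 "Special notions of
  symmetry and invariance": (1), Lemma 11.2 (coding), Prop. 11.3 (uniqueness and inversion) and its
  proof, pp. 204–205.
* G. Last, M. Penrose, *Lectures on the Poisson Process* (2017), Thm. 9.1 (refined Campbell
  theorem), §9.4 (inversion).
* J. Mecke, *Stationäre zufällige Maße auf lokalkompakten Abelschen Gruppen*, Z. Wahrsch. 9 (1967),
  Satz 2.3 (the averaging argument).
-/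

noncomputable section

open MeasureTheory Set Filter Function
open scoped ENNReal Topology ProbabilityTheory
open Literature.Analysis.FunctionSpaces

namespace Literature.Analysis.FluidPDE

/-! ## Translation algebra of configurations

Three folklore identities for `PointConfig.translate` (copies, under names local to this file's
namespace, of `PointConfig.translate_translate` / `translate_zero_eq_id` of
`Literature/Barriers/AtomisticToContinuum/HardDiskTranslationInvarianceSteps.lean`, which is not
imported so that the Palm frame does not depend on the hard-disc barrier files). -/

section TranslateAlgebra

variable {E : Type*} [TopologicalSpace E] [AddGroup E] [ContinuousAdd E]

/-- Iterated translations compose: `(ω + u) + v = ω + (u + v)`. [folklore] -/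
theorem pointConfig_translate_translate
    (ω : PointConfig E) (u v : E) : (ω.translate u).translate v = ω.translate (u + v) := by
  refine SetLike.ext' ?_
  show (· + v) '' ((· + u) '' ω.carrier) = (· + (u + v)) '' ω.carrier
  rw [image_image]
  simp_rw [add_assoc]

/-- Translation by `0` is the identity. [folklore] -/
@[simp]
theorem pointConfig_translate_zero (ω : PointConfig E) :
    ω.translate 0 = ω := by
  refine SetLike.ext' ?_
  show (· + (0 : E)) '' ω.carrier = ω.carrier
  simp

/-- Sums over the points of a translated configuration are sums over the original points.
[folklore] -/
theorem tsum_pointConfig_translate {α : Type*}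
    [AddCommMonoid α] [TopologicalSpace α] (ω : PointConfig E) (v : E) (f : E → α) :
    ∑' p : ((ω.translate v : PointConfig E) : Set E), f p = ∑' p : (ω : Set E), f ((p : E) + v) := by
  show ∑' p : ((· + v) '' ω.carrier), f p = ∑' p : ω.carrier, f ((p : E) + v)
  exact tsum_image f (add_left_injective v).injOn

end TranslateAlgebra

/-! ## The refined Campbell theorem, Palm inversion and uniqueness (Kallenberg Prop. 11.3)

(No local notation: `EuclideanSpace ℝ d` is written out; `p.1.1` is the position of the particle
`p.1 = ↑p` for `p` ranging over the points `↥(ω : Set _)` of a configuration.) -/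

section PalmInversion

variable {d : Type*} [Fintype d]

/-- The unit cube `[0,1)ᵈ` has Lebesgue measure `1` (private copy of `Torus.volume_unitCube` of
`TorusGridCellsGeometry`, which is not imported here). [folklore] -/
private theorem volume_torusUnitCube : volume (Torus.unitCube d) = 1 := by
  have hpre : Torus.unitCube d =
      (@WithLp.ofLp 2 (d → ℝ)) ⁻¹' Set.pi univ fun _ : d => Ico (0 : ℝ) 1 := by
    ext y
    simp [Torus.mem_unitCube]
  rw [hpre, (PiLp.volume_preserving_ofLp d).measure_preimage
    (MeasurableSet.univ_pi fun _ => measurableSet_Ico).nullMeasurableSet, volume_pi_pi]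
  simp

/-- **Stationarity in Campbell form**: for a translation-invariant `P`, shifting the configuration
and the tagged particle together leaves the Campbell integrals `E_P ∑_{p ∈ ω} F(ω, p)` unchanged
(Kallenberg, proof of Lemma 11.2:
`∫ 1_B(u) f(θ_{u+t}(X,ξ)) ξ(du + t) = ∫_B f(θ_u θ_t(X,ξ)) (θ_t ξ)(du)` and `θ_t(X, ξ) =ᵈ (X, ξ)`).
[cite: Kallenberg2021, Lemma 11.2] -/
theorem lintegral_tsum_translate_eq
    {P : Measure (PointConfig (EuclideanSpace ℝ d × EuclideanSpace ℝ d))}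
    (hP : IsTranslationInvariant P)
    {F : PointConfig (EuclideanSpace ℝ d × EuclideanSpace ℝ d) ×
      (EuclideanSpace ℝ d × EuclideanSpace ℝ d) → ℝ≥0∞}
    (hF : Measurable F) (a : EuclideanSpace ℝ d) :
    ∫⁻ ω, ∑' p : (ω : Set (EuclideanSpace ℝ d × EuclideanSpace ℝ d)),
        F (ω.translate (a, 0), p.1 + (a, 0)) ∂P =
      ∫⁻ ω, ∑' p : (ω : Set (EuclideanSpace ℝ d × EuclideanSpace ℝ d)), F (ω, p) ∂P := by
  have hG : Measurable fun ω : PointConfig (EuclideanSpace ℝ d × EuclideanSpace ℝ d) =>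
      ∑' p : (ω : Set (EuclideanSpace ℝ d × EuclideanSpace ℝ d)), F (ω, p) :=
    PointConfig.measurable_tsum_carrier hF measurable_id
  calc ∫⁻ ω, ∑' p : (ω : Set (EuclideanSpace ℝ d × EuclideanSpace ℝ d)),
        F (ω.translate (a, 0), p.1 + (a, 0)) ∂P
      = ∫⁻ ω, ∑' p : ((ω.translate (a, 0) :
            PointConfig (EuclideanSpace ℝ d × EuclideanSpace ℝ d)) :
              Set (EuclideanSpace ℝ d × EuclideanSpace ℝ d)), F (ω.translate (a, 0), p) ∂P := by
        refine lintegral_congr fun ω => ?_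
        exact (tsum_pointConfig_translate ω ((a, 0) : EuclideanSpace ℝ d × EuclideanSpace ℝ d)
          fun p => F (ω.translate (a, 0), p)).symm
    _ = ∫⁻ ω, ∑' p : (ω : Set (EuclideanSpace ℝ d × EuclideanSpace ℝ d)), F (ω, p)
          ∂(P.map (PointConfig.translate ((a, 0) : EuclideanSpace ℝ d × EuclideanSpace ℝ d))) :=
        (lintegral_map hG (PointConfig.measurable_translate _)).symm
    _ = ∫⁻ ω, ∑' p : (ω : Set (EuclideanSpace ℝ d × EuclideanSpace ℝ d)), F (ω, p) ∂P := by
        rw [hP a]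

/-- Stationarity in Campbell form, for the Campbell measure `C_P = P ⊗ₘ countKernel`:
`C_P` is invariant under `(ω, p) ↦ (ω + (a, 0), p + (a, 0))`. [cite: Kallenberg2021, Lemma 11.2] -/
theorem lintegral_compProd_countKernel_translate_eq
    (P : Measure (PointConfig (EuclideanSpace ℝ d × EuclideanSpace ℝ d))) [SFinite P]
    (hP : IsTranslationInvariant P)
    {F : PointConfig (EuclideanSpace ℝ d × EuclideanSpace ℝ d) ×
      (EuclideanSpace ℝ d × EuclideanSpace ℝ d) → ℝ≥0∞}
    (hF : Measurable F) (a : EuclideanSpace ℝ d) :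
    ∫⁻ q, F (q.1.translate (a, 0), q.2 + (a, 0)) ∂(P ⊗ₘ PointConfig.countKernel) =
      ∫⁻ q, F q ∂(P ⊗ₘ PointConfig.countKernel) := by
  have hT : Measurable fun q : PointConfig (EuclideanSpace ℝ d × EuclideanSpace ℝ d) ×
      (EuclideanSpace ℝ d × EuclideanSpace ℝ d) => (q.1.translate (a, 0), q.2 + (a, 0)) :=
    ((PointConfig.measurable_translate _).comp measurable_fst).prodMk (measurable_snd.add_const _)
  rw [lintegral_compProd_countKernel P (f := fun q => F (q.1.translate (a, 0), q.2 + (a, 0)))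
    (hF.comp hT), lintegral_compProd_countKernel P hF]
  exact lintegral_tsum_translate_eq hP hF a

/-- Re-rooting is blind to a common shift of the configuration and the tagged particle:
`θ_{x_p + a}(ω + (a, 0)) = θ_{x_p} ω`. [folklore] -/
theorem recentre_translate (ω : PointConfig (EuclideanSpace ℝ d × EuclideanSpace ℝ d))
    (p : EuclideanSpace ℝ d × EuclideanSpace ℝ d) (a : EuclideanSpace ℝ d) :
    recentre (ω.translate (a, 0), p + (a, 0)) = recentre (ω, p) := by
  simp only [recentre_apply, pointConfig_translate_translate, Prod.fst_add, Prod.mk_add_mk,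
    add_zero, neg_add_rev, add_neg_cancel_left]

/-- **Refined Campbell theorem, window form** (Kallenberg Ch. 11, proof of Prop. 11.3, the
extension of (1): `E ξ̄ · E ∫ h(Y, η, s) ds = E ∫ h(θ_s(X, ξ), s) ξ(ds)`; Last–Penrose Thm. 9.1): for
a translation-invariant `P` and jointly measurable `h ≥ 0`,
`E_P ∑_{p ∈ ω} h(ω - (x_p, 0), x_p) = E_P ∑_{p ∈ ω, x_p ∈ [0,1)ᵈ} ∫ h(ω - (x_p, 0), z) dz`.
Proved by Mecke's averaging argument — insert `1 = ∫ 1_{[0,1)ᵈ}(x_p + y) dy`, exchange the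
integrals, shift by `-y` (stationarity in Campbell form), exchange back, and use the translation
invariance of Lebesgue measure — instead of the printed monotone-class extension of (1).
[cite: Kallenberg2021, Ch. 11, proof of Prop. 11.3] -/
theorem lintegral_tsum_recentre_eq
    (P : Measure (PointConfig (EuclideanSpace ℝ d × EuclideanSpace ℝ d))) [SFinite P]
    (hP : IsTranslationInvariant P)
    {h : PointConfig (EuclideanSpace ℝ d × EuclideanSpace ℝ d) × EuclideanSpace ℝ d → ℝ≥0∞}
    (hh : Measurable h) :
    ∫⁻ ω, ∑' p : (ω : Set (EuclideanSpace ℝ d × EuclideanSpace ℝ d)),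
        h (ω.translate (-p.1.1, 0), p.1.1) ∂P =
      ∫⁻ ω, ∑' p : particlesIn ω (Torus.unitCube d),
        (∫⁻ z, h (ω.translate (-p.1.1, 0), z)) ∂P := by
  set C : Set (EuclideanSpace ℝ d) := Torus.unitCube d with hCdef
  have hCm : MeasurableSet C := Torus.measurableSet_unitCube
  have hvol : volume C = 1 := volume_torusUnitCube
  have h1C : Measurable (C.indicator (1 : EuclideanSpace ℝ d → ℝ≥0∞)) :=
    measurable_one.indicator hCm
  -- measurability of the integrands
  have hhθ : Measurable fun q : PointConfig (EuclideanSpace ℝ d × EuclideanSpace ℝ d) ×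
      (EuclideanSpace ℝ d × EuclideanSpace ℝ d) => h (recentre q, q.2.1) :=
    hh.comp (measurable_recentre.prodMk measurable_snd.fst)
  have hΦ : Measurable fun r : (PointConfig (EuclideanSpace ℝ d × EuclideanSpace ℝ d) ×
      (EuclideanSpace ℝ d × EuclideanSpace ℝ d)) × EuclideanSpace ℝ d =>
      h (recentre r.1, r.1.2.1) * C.indicator 1 (r.1.2.1 + r.2) :=
    (hhθ.comp measurable_fst).mul (h1C.comp (measurable_fst.snd.fst.add measurable_snd))
  have hΨ : Measurable fun r : (PointConfig (EuclideanSpace ℝ d × EuclideanSpace ℝ d) ×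
      (EuclideanSpace ℝ d × EuclideanSpace ℝ d)) × EuclideanSpace ℝ d =>
      C.indicator 1 r.1.2.1 * h (recentre r.1, r.1.2.1 - r.2) :=
    (h1C.comp measurable_fst.snd.fst).mul
      (hh.comp ((measurable_recentre.comp measurable_fst).prodMk
        (measurable_fst.snd.fst.sub measurable_snd)))
  have hg : Measurable fun q : PointConfig (EuclideanSpace ℝ d × EuclideanSpace ℝ d) ×
      (EuclideanSpace ℝ d × EuclideanSpace ℝ d) =>
      C.indicator 1 q.2.1 * ∫⁻ z, h (recentre q, z) ∂volume :=
    (h1C.comp measurable_snd.fst).mul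
      ((hh.comp ((measurable_recentre.comp measurable_fst).prodMk
        measurable_snd)).lintegral_prod_right')
  calc ∫⁻ ω, ∑' p : (ω : Set (EuclideanSpace ℝ d × EuclideanSpace ℝ d)),
        h (ω.translate (-p.1.1, 0), p.1.1) ∂P
      = ∫⁻ q, h (recentre q, q.2.1) ∂(P ⊗ₘ PointConfig.countKernel) :=
        (lintegral_compProd_countKernel P hhθ).symm
    _ = ∫⁻ q, ∫⁻ y, h (recentre q, q.2.1) * C.indicator 1 (q.2.1 + y) ∂volume
          ∂(P ⊗ₘ PointConfig.countKernel) := by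
        refine lintegral_congr fun q => ?_
        rw [lintegral_const_mul _ (show Measurable (fun y : EuclideanSpace ℝ d =>
              C.indicator (1 : EuclideanSpace ℝ d → ℝ≥0∞) (q.2.1 + y))
            from h1C.comp (measurable_const_add q.2.1)),
          lintegral_add_left_eq_self (C.indicator (1 : EuclideanSpace ℝ d → ℝ≥0∞)) q.2.1,
          lintegral_indicator_one hCm, hvol, mul_one]
    _ = ∫⁻ y, ∫⁻ q, h (recentre q, q.2.1) * C.indicator 1 (q.2.1 + y)
          ∂(P ⊗ₘ PointConfig.countKernel) ∂volume :=
        lintegral_lintegral_swap hΦ.aemeasurable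
    _ = ∫⁻ y, ∫⁻ q, C.indicator 1 q.2.1 * h (recentre q, q.2.1 - y)
          ∂(P ⊗ₘ PointConfig.countKernel) ∂volume := by
        refine lintegral_congr fun y => ?_
        have hFy : Measurable fun q : PointConfig (EuclideanSpace ℝ d × EuclideanSpace ℝ d) ×
            (EuclideanSpace ℝ d × EuclideanSpace ℝ d) =>
            h (recentre q, q.2.1) * C.indicator 1 (q.2.1 + y) :=
          hhθ.mul (h1C.comp (measurable_snd.fst.add_const y))
        rw [← lintegral_compProd_countKernel_translate_eq P hP hFy (-y)]
        refine lintegral_congr fun q => ?_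
        obtain ⟨ω, x, v⟩ := q
        rw [recentre_translate]
        simp only [Prod.mk_add_mk, ← sub_eq_add_neg, sub_add_cancel]
        rw [mul_comm]
    _ = ∫⁻ q, ∫⁻ y, C.indicator 1 q.2.1 * h (recentre q, q.2.1 - y) ∂volume
          ∂(P ⊗ₘ PointConfig.countKernel) :=
        (lintegral_lintegral_swap hΨ.aemeasurable).symm
    _ = ∫⁻ q, C.indicator 1 q.2.1 * ∫⁻ z, h (recentre q, z) ∂volume
          ∂(P ⊗ₘ PointConfig.countKernel) := by
        refine lintegral_congr fun q => ?_
        rw [lintegral_const_mul _ (show Measurable (fun y : EuclideanSpace ℝ d =>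
              h (recentre q, q.2.1 - y)) from
            hh.comp (measurable_const.prodMk (measurable_id.const_sub q.2.1))),
          lintegral_sub_left_eq_self (fun z => h (recentre q, z)) q.2.1]
    _ = ∫⁻ ω, ∑' p : particlesIn ω (Torus.unitCube d),
          (∫⁻ z, h (ω.translate (-p.1.1, 0), z)) ∂P := by
        rw [lintegral_compProd_countKernel P hg]
        refine lintegral_congr fun ω => ?_
        rw [tsum_particlesIn_eq ω (Torus.unitCube d)
          fun p : EuclideanSpace ℝ d × EuclideanSpace ℝ d => ∫⁻ z, h (ω.translate (-p.1, 0), z)]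
        refine tsum_congr fun p => ?_
        simp only [indicator, mem_setOf_eq, Pi.one_apply, recentre_apply, hCdef]
        split_ifs <;> simp

/-- **Refined Campbell theorem** (Kallenberg Ch. 11, proof of Prop. 11.3:
`E ξ̄ · E ∫ h(Y, η, s) ds = E ∫ h(θ_s(X, ξ), s) ξ(ds)`; Last–Penrose Thm. 9.1 (9.3)): for a
translation-invariant `P` with intensity `ρ ∈ (0, ∞)` and jointly measurable `h ≥ 0`,
`E_P ∑_{p ∈ ω} h(ω - (x_p, 0), x_p) = ρ ∫∫ h(η, z) dz P⁰(dη)`.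
[cite: Kallenberg2021, Ch. 11, proof of Prop. 11.3] -/
theorem lintegral_tsum_recentre_eq_mul_palmLaw
    (P : Measure (PointConfig (EuclideanSpace ℝ d × EuclideanSpace ℝ d))) [SFinite P]
    (hP : IsTranslationInvariant P) (h0 : intensity P ≠ 0) (htop : intensity P ≠ ∞)
    {h : PointConfig (EuclideanSpace ℝ d × EuclideanSpace ℝ d) × EuclideanSpace ℝ d → ℝ≥0∞}
    (hh : Measurable h) :
    ∫⁻ ω, ∑' p : (ω : Set (EuclideanSpace ℝ d × EuclideanSpace ℝ d)),
        h (ω.translate (-p.1.1, 0), p.1.1) ∂P =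
      intensity P * ∫⁻ η, ∫⁻ z, h (η, z) ∂volume ∂(palmLaw P) := by
  rw [lintegral_tsum_recentre_eq P hP hh, lintegral_palmLaw P hh.lintegral_prod_right',
    ← mul_assoc, ENNReal.mul_inv_cancel h0 htop, one_mul]

/-- **Kallenberg's formula (2)** (proof of Prop. 11.3, with `h(x, μ, s) = f(θ_{-s}(x, μ), s)`:
`E ξ̄ · E ∫ f(θ_s(Y, η), -s) ds = E ∫ f(X, ξ, s) ξ(ds)`, here without the final substitution
`s ↦ -s`): `E_P ∑_{p ∈ ω} F(ω, x_p) = ρ ∫∫ F(η + (s, 0), s) ds P⁰(dη)`.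
[cite: Kallenberg2021, Ch. 11, proof of Prop. 11.3, (2)] -/
theorem lintegral_tsum_eq_mul_palmLaw
    (P : Measure (PointConfig (EuclideanSpace ℝ d × EuclideanSpace ℝ d))) [SFinite P]
    (hP : IsTranslationInvariant P) (h0 : intensity P ≠ 0) (htop : intensity P ≠ ∞)
    {F : PointConfig (EuclideanSpace ℝ d × EuclideanSpace ℝ d) × EuclideanSpace ℝ d → ℝ≥0∞}
    (hF : Measurable F) :
    ∫⁻ ω, ∑' p : (ω : Set (EuclideanSpace ℝ d × EuclideanSpace ℝ d)), F (ω, p.1.1) ∂P =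
      intensity P * ∫⁻ η, ∫⁻ s, F (η.translate (s, 0), s) ∂volume ∂(palmLaw P) := by
  have hT : Measurable fun r : PointConfig (EuclideanSpace ℝ d × EuclideanSpace ℝ d) ×
      EuclideanSpace ℝ d => (r.1.translate (r.2, 0), r.2) :=
    ((measurable_snd.prodMk measurable_const).pointConfig_translate measurable_fst).prodMk
      measurable_snd
  have key := lintegral_tsum_recentre_eq_mul_palmLaw P hP h0 htop
    (h := fun r => F (r.1.translate (r.2, 0), r.2)) (hF.comp hT)
  refine Eq.trans ?_ key
  refine lintegral_congr fun ω => tsum_congr fun p => ?_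
  show F (ω, p.1.1) = F ((ω.translate (-p.1.1, 0)).translate (p.1.1, 0), p.1.1)
  rw [pointConfig_translate_translate, Prod.mk_add_mk, neg_add_cancel, add_zero,
    show (((0 : EuclideanSpace ℝ d), (0 : EuclideanSpace ℝ d)) :
      EuclideanSpace ℝ d × EuclideanSpace ℝ d) = 0 from rfl, pointConfig_translate_zero]

/-- **`ξ g < ∞` a.s.** (Kallenberg, proof of Prop. 11.3 (i): "if `g > 0` with `λᵈ g < ∞`, then
`ξ g < ∞` a.s."): for a translation-invariant `P` of finite intensity and `k ≥ 0` integrable,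
`∑_{p ∈ ω} k(x_p) < ∞` for `P`-a.e. `ω` (its expectation is `ρ ∫ k`).
[cite: Kallenberg2021, Ch. 11, proof of Prop. 11.3 (i)] -/
theorem ae_tsum_weight_lt_top
    (P : Measure (PointConfig (EuclideanSpace ℝ d × EuclideanSpace ℝ d))) [SFinite P]
    (hP : IsTranslationInvariant P) (htop : intensity P ≠ ∞)
    {k : EuclideanSpace ℝ d → ℝ≥0∞} (hk : Measurable k) (hkint : ∫⁻ s, k s ∂volume ≠ ∞) :
    ∀ᵐ ω : PointConfig (EuclideanSpace ℝ d × EuclideanSpace ℝ d) ∂P,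
      ∑' p : (ω : Set (EuclideanSpace ℝ d × EuclideanSpace ℝ d)), k p.1.1 < ∞ := by
  have hS : Measurable fun ω : PointConfig (EuclideanSpace ℝ d × EuclideanSpace ℝ d) =>
      ∑' p : (ω : Set (EuclideanSpace ℝ d × EuclideanSpace ℝ d)), k p.1.1 :=
    PointConfig.measurable_tsum_carrier
      (f := fun q : PointConfig (EuclideanSpace ℝ d × EuclideanSpace ℝ d) ×
        (EuclideanSpace ℝ d × EuclideanSpace ℝ d) => k q.2.1)
      (hk.comp measurable_snd.fst) measurable_id
  refine ae_lt_top hS ?_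
  have key : ∫⁻ ω, ∑' p : (ω : Set (EuclideanSpace ℝ d × EuclideanSpace ℝ d)), k p.1.1 ∂P =
      ∫⁻ ω, ∑' _ : particlesIn ω (Torus.unitCube d), ∫⁻ z, k z ∂volume ∂P :=
    lintegral_tsum_recentre_eq P hP (h := fun r => k r.2) (hk.comp measurable_snd)
  have hcount : ∀ ω : PointConfig (EuclideanSpace ℝ d × EuclideanSpace ℝ d),
      ((particlesIn ω (Torus.unitCube d)).encard : ℝ≥0∞) =
        ((ω.count (Torus.unitCube d ×ˢ (univ : Set (EuclideanSpace ℝ d))) : ℕ∞) : ℝ≥0∞) := by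
    intro ω
    rw [particlesIn_eq, PointConfig.count, prod_univ]
    rfl
  rw [key]
  simp_rw [ENNReal.tsum_set_const, hcount]
  rw [lintegral_mul_const' _ _ hkint]
  exact ENNReal.mul_ne_top htop hkint

/-- **Kallenberg's inversion formula** (Prop. 11.3 (i): for `f ≥ 0` and `g > 0` with `λᵈ g < ∞`,
`E[f(X, ξ); ξ ≠ 0] = E ξ̄ · E ∫ f(θ_s(Y, η)) g(-s) / ((θ_s η) g) ds`; here with `s ↦ -s` undone,
`(θ_{-s} η) g = ∑_{q ∈ η + (s,0)} g(x_q)`): the restriction of a translation-invariant `P` with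
intensity in `(0, ∞)` to the nonempty configurations is an explicit functional of its intensity and
its Palm law. [cite: Kallenberg2021, Prop. 11.3 (i)] -/
theorem lintegral_indicator_count_ne_zero_eq_mul_palmLaw
    (P : Measure (PointConfig (EuclideanSpace ℝ d × EuclideanSpace ℝ d))) [SFinite P]
    (hP : IsTranslationInvariant P) (h0 : intensity P ≠ 0) (htop : intensity P ≠ ∞)
    {k : EuclideanSpace ℝ d → ℝ≥0∞} (hk : Measurable k) (hkpos : ∀ s, k s ≠ 0)
    (hkint : ∫⁻ s, k s ∂volume ≠ ∞)
    {f : PointConfig (EuclideanSpace ℝ d × EuclideanSpace ℝ d) → ℝ≥0∞} (hf : Measurable f) :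
    ∫⁻ ω, {ω : PointConfig (EuclideanSpace ℝ d × EuclideanSpace ℝ d) |
        ω.count univ ≠ 0}.indicator f ω ∂P =
      intensity P * ∫⁻ η, ∫⁻ s, f (η.translate (s, 0)) * (k s *
        (∑' q : ((η.translate (s, 0) : PointConfig (EuclideanSpace ℝ d × EuclideanSpace ℝ d)) :
          Set (EuclideanSpace ℝ d × EuclideanSpace ℝ d)), k q.1.1)⁻¹) ∂volume ∂(palmLaw P) := by
  have hS : Measurable fun ω : PointConfig (EuclideanSpace ℝ d × EuclideanSpace ℝ d) =>
      ∑' q : (ω : Set (EuclideanSpace ℝ d × EuclideanSpace ℝ d)), k q.1.1 :=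
    PointConfig.measurable_tsum_carrier
      (f := fun q : PointConfig (EuclideanSpace ℝ d × EuclideanSpace ℝ d) ×
        (EuclideanSpace ℝ d × EuclideanSpace ℝ d) => k q.2.1)
      (hk.comp measurable_snd.fst) measurable_id
  have hF : Measurable fun r : PointConfig (EuclideanSpace ℝ d × EuclideanSpace ℝ d) ×
      EuclideanSpace ℝ d =>
      f r.1 * (k r.2 * (∑' q : (r.1 : Set (EuclideanSpace ℝ d × EuclideanSpace ℝ d)), k q.1.1)⁻¹) :=
    (hf.comp measurable_fst).mul ((hk.comp measurable_snd).mul (hS.comp measurable_fst).inv)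
  have key := lintegral_tsum_eq_mul_palmLaw P hP h0 htop hF
  refine Eq.trans ?_ key
  refine lintegral_congr_ae ?_
  filter_upwards [ae_tsum_weight_lt_top P hP htop hk hkint] with ω hω
  show _ = ∑' p : (ω : Set (EuclideanSpace ℝ d × EuclideanSpace ℝ d)),
    f ω * (k p.1.1 * (∑' q : (ω : Set (EuclideanSpace ℝ d × EuclideanSpace ℝ d)), k q.1.1)⁻¹)
  rw [ENNReal.tsum_mul_left, ENNReal.tsum_mul_right]
  by_cases hω0 : ω.count univ = 0
  · -- the empty configuration: both sides vanish
    have hempty : (ω : Set (EuclideanSpace ℝ d × EuclideanSpace ℝ d)) = ∅ := by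
      rw [PointConfig.count, inter_univ, Set.encard_eq_zero] at hω0
      exact hω0
    have hnot : ω ∉ {ω : PointConfig (EuclideanSpace ℝ d × EuclideanSpace ℝ d) |
        ω.count univ ≠ 0} := by
      simpa using hω0
    rw [indicator_of_notMem hnot, hempty, tsum_empty, zero_mul, mul_zero]
  · -- a nonempty configuration: `0 < ∑_q k(x_q) < ∞`
    have hne : (ω : Set (EuclideanSpace ℝ d × EuclideanSpace ℝ d)).Nonempty := by
      rw [PointConfig.count, inter_univ] at hω0
      exact Set.encard_ne_zero.1 hω0
    obtain ⟨p, hp⟩ := hne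
    have hSpos : ∑' q : (ω : Set (EuclideanSpace ℝ d × EuclideanSpace ℝ d)), k q.1.1 ≠ 0 :=
      ne_of_gt (lt_of_lt_of_le (pos_iff_ne_zero.2 (hkpos p.1))
        (ENNReal.le_tsum (⟨p, hp⟩ : (ω : Set (EuclideanSpace ℝ d × EuclideanSpace ℝ d)))))
    have hmem : ω ∈ {ω : PointConfig (EuclideanSpace ℝ d × EuclideanSpace ℝ d) |
        ω.count univ ≠ 0} := hω0
    rw [indicator_of_mem hmem, ENNReal.mul_inv_cancel hSpos hω.ne, mul_one]

/-- **Uniqueness in the Palm correspondence** (discharge of `PalmUniqueness`; Kallenberg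
Prop. 11.3: by the inversion formula (i), `P[· ; ξ ≠ 0]` is a functional of the intensity and the
Palm law, and `P{ξ = 0} = 1 - P{ξ ≠ 0}` with `{ξ = 0} = {∅}` a single configuration). The weight
used is `g(s) = (1 + |s|)^{-(d+1)}` (`finite_integral_one_add_norm`).
[cite: Kallenberg2021, Prop. 11.3] -/
theorem PalmUniqueness_holds : PalmUniqueness (d := d) := by
  intro P P' hP hP' hT hT' h0 htop hρ hQ
  -- the weight `k(s) = (1 + |s|)^{-(card d + 1)}`: positive, measurable, integrable
  set k : EuclideanSpace ℝ d → ℝ≥0∞ :=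
    fun s => ENNReal.ofReal ((1 + ‖s‖) ^ (-((Fintype.card d : ℝ) + 1))) with hkdef
  have hbase : ∀ s : EuclideanSpace ℝ d, (1 + ‖s‖ : ℝ) ≠ 0 := fun s => by positivity
  have hk : Measurable k :=
    ENNReal.measurable_ofReal.comp ((Continuous.rpow_const
      (f := fun s : EuclideanSpace ℝ d => (1 + ‖s‖ : ℝ))
      (continuous_const.add continuous_norm) fun s => Or.inl (hbase s))).measurable
  have hkpos : ∀ s, k s ≠ 0 := fun s =>
    (ENNReal.ofReal_pos.2 (Real.rpow_pos_of_pos (by positivity) _)).ne'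
  have hkint : ∫⁻ s, k s ∂volume ≠ ∞ :=
    (finite_integral_one_add_norm (by rw [finrank_euclideanSpace]; exact lt_add_one _)).ne
  have h0' : intensity P' ≠ 0 := by rw [hρ]; exact h0
  have htop' : intensity P' ≠ ∞ := by rw [hρ]; exact htop
  -- the event `{ξ ≠ 0}` of nonempty configurations
  set N : Set (PointConfig (EuclideanSpace ℝ d × EuclideanSpace ℝ d)) :=
    {ω | ω.count univ ≠ 0} with hNdef
  have hN : MeasurableSet N :=
    PointConfig.measurable_count MeasurableSet.univ
      (MeasurableSpace.measurableSet_top (s := {n : ℕ∞ | n ≠ 0}))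
  -- `P'[· ; ξ ≠ 0] = P[· ; ξ ≠ 0]` by the inversion formula
  have heq : ∀ {f : PointConfig (EuclideanSpace ℝ d × EuclideanSpace ℝ d) → ℝ≥0∞},
      Measurable f → ∫⁻ ω, N.indicator f ω ∂P' = ∫⁻ ω, N.indicator f ω ∂P := by
    intro f hf
    rw [hNdef, lintegral_indicator_count_ne_zero_eq_mul_palmLaw P' hT' h0' htop' hk hkpos hkint hf,
      lintegral_indicator_count_ne_zero_eq_mul_palmLaw P hT h0 htop hk hkpos hkint hf, hρ, hQ]
  have hNeq : P' N = P N := by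
    have h1 := heq measurable_one
    rwa [lintegral_indicator_one hN, lintegral_indicator_one hN] at h1
  -- the complement `{ξ = 0}` is the single configuration `∅`
  have hNc : ∀ ω : PointConfig (EuclideanSpace ℝ d × EuclideanSpace ℝ d), ω ∈ Nᶜ → ω = ∅ := by
    intro ω hω
    have hω' : ¬ω.count univ ≠ 0 := hω
    rw [not_not, PointConfig.count, inter_univ, Set.encard_eq_zero] at hω'
    exact SetLike.ext' hω'
  ext A hA
  rw [← measure_inter_add_sdiff A hN, ← measure_inter_add_sdiff (μ := P) A hN]
  congr 1
  · have h1 := heq (measurable_one.indicator hA)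
    rwa [indicator_indicator, lintegral_indicator_one (hN.inter hA),
      lintegral_indicator_one (hN.inter hA), inter_comm] at h1
  · by_cases he : (∅ : PointConfig (EuclideanSpace ℝ d × EuclideanSpace ℝ d)) ∈ A
    · have hAN : A \ N = Nᶜ := by
        ext ω
        refine ⟨fun h => h.2, fun h => ⟨?_, h⟩⟩
        rw [hNc ω h]
        exact he
      rw [hAN, prob_compl_eq_one_sub hN, prob_compl_eq_one_sub hN, hNeq]
    · have hAN : A \ N = ∅ :=
        Set.eq_empty_iff_forall_notMem.2 fun ω hω => he (by rw [← hNc ω hω.2]; exact hω.1)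
      rw [hAN, measure_empty, measure_empty]

end PalmInversion

end Literature.Analysis.FluidPDE
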